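import Summits.QuantumFields.BalabanUV.T4Continuum.Support.SubstrateAvgTowerFactorisation
import Summits.QuantumFields.BalabanUV.T4Continuum.Support.RegularBackgroundTower

/-!
# SUBSTRATE — W-28a = σ-W «β″ IN THE WINDOW»: the finest (3.36)-SHAPE SECOND-ORDER WINDOW LETTER `β''` and the plumbing of W-25b §2's displayed
# binder `hlipD` (NE5 owner R60 (2) l.24769: the W1 real window of record is AMENDED to carry β″; t4-dagwriter Q52 (2) l.24813: σ-W = a substrate DISPLAY;
# typer (σ2-3)∕(σ7) sketch `substrate/typer/SketchW28SecondOrderWindow.v0.15.1.lean` cf902fd48e49109f; fact F-SECOND = NE5 leaf-08 g19's kernel witness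
# `RegularTowerSecondOrderWitness.no_uniform_hlipD` ∕ `no_uniform_localRateOn_regClass`: (ℓ2)(ℓ4) are NOT derivable K-uniformly from the (3.35)-shape letters (α′, β′))

Cell `pub-balaban`, SUBSTRATE cell.  Summits-side under the LEAN PLACEMENT RULE.  Over tree declarations only (PART 3 `SubstrateAvgTowerFactorisation` +
`RegularBackgroundTower`; it does NOT import W-25b `SubstrateAvgTowerRegularity` — the two files are independent):
§1 the pure-algebra SECOND-DIFFERENCE IDENTITY for `dconnTower` (any transporter tower `R`): at `i = τ_μ i₀`,
   `D_μw_μ(τ_ν i) − D_μw_μ(i) = lev • lev • (R_μ(τ_ν τ_μ i₀) − R_μ(τ_μ i₀) − R_μ(τ_ν i₀) + R_μ(i₀))` (`dconnTower_tau_sub`; `fineTau_comm`);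
§2 HYPOTHESIS SHAPE `SecondOrderWindow P ι V β'' := ∀ x μ ν ρ, L^K·‖ι V((x+e_ν)+e_ρ, μ) − ι V(x+e_ν, μ) − ι V(x+e_ρ, μ) + ι V(x, μ)‖ ≤ β''∕(L^K)²` — the
   finest second-difference letter in W-25b's `h := (L:ℝ)^K` currency (memo `t4/T4-EST-NE5-JAVG-SECOND.md` §1 (W2); = R60 (2)'s `(L^K)³·‖Δ_ν Δ_μ⁻ (ι V)‖ ≤ β″` after
   the index shift `Δ_ν Δ_μ⁻ R (τ_μ i₀) = Δ_ν Δ_μ R (i₀)`), its reading in PART 3's clause currency `fin_second_clause` (`‖ℓ•ℓ•Δ²S‖ ≤ β''∕ℓ`, `k ≥ K`, over `axialTower V` = JUNCTION J-σ, the finest input letter of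
   the NE5 owner's abstract second-order induction g39-d) and its DISCHARGE of `hlipD` AT EVERY LEVEL `k ≥ K` with `βD := β''` (`hlipD_finest_of_secondOrderWindow`;
   `k = K`: PART 3's chart dictionary `siteIdx_shift` ∕ `towerOf_chart'` ∕ `fin_eq_clause` exactly as `fin_lip_clause` reads β′; `k > K`: the tower is `1`);
§3 the ASSEMBLY of W-25b §2's all-levels binder `hlipD` from §2 + the binder `hbelow : ∀ k < P.K, …` = the PROPAGATION of β″ through the averaging tower
   BELOW the finest level, DISPLAYED PER LEVEL and NOT claimed here ([Balaban1985Averaging] Props 5–10 KIND; abstract half BOOKED to the NE5 owner as g39-d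
   `B13ReadingsAvgTowerSecond`, instance letters σ-L1 ∕ σ-L2 ∕ σ-END UNCLAIMED — Q52), plain and in the `∀ b ∈ dom` binder shape of
   `hloc_avgTower_on_levelWindow_dom`.  The windowed one-step letter `hbavgD` (levels `k + 1 ≤ K` only) has NO finest-level part and stays displayed.

HONEST FRAMING: rung (B)+1 plumbing of the FINITE-VOLUME T⁴ programme — NOT infinite volume, NOT a mass gap, NOT Clay; spine PROVED 0∕9; NE5 ∕ NE2 NOT
PRINTED ∕ NOT PROVED; NO estimate is proved here: β″ is a DISPLAYED window letter (print KIND: [Balaban1985BackgroundPropagators] (3.36) p. 396; print's regular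
spaces [Balaban1985RegularSpaces] (1.7)–(1.9) also carry a covariant-divergence condition — displayed by nobody, asserted by nobody) and `hbelow` is a hypothesis;
nothing of Bałaban's is instantiated.  HONEST DEPENDENCY (cell line, verbatim): continuum YM on T⁴ ⇐ BetaPertH ∧ nine spine estimates (0/9 proved); BetaPertH ⇐
(D1) ∧ (D4) ∧ CAP+tail; G-an2-4 gates asym, D1 and NE2/3/4.  0 sorry; axioms ⊆ {propext, Classical.choice, Quot.sound}.
-/

noncomputable section

open scoped BigOperators Matrix Matrix.Norms.L2Operator

namespace Summit.QuantumFields.BalabanUV.T4Continuum.SubstrateSecondOrderWindow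

open Literature.MathematicalPhysics.QuantumFieldTheory.Balaban1983to89
open Literature.MathematicalPhysics.QuantumFieldTheory.Balaban1983to89.B5Prop11Plancherel (Tor fine unitVec)
open Literature.MathematicalPhysics.QuantumFieldTheory.Balaban1983to89.B5G183RateUnitTower (lev lev_neZero)
open Summit.QuantumFields.BalabanUV.T4Continuum
open Summit.QuantumFields.BalabanUV.T4Continuum.BalabanAveragedTowerUnit (idx cast_lev')
open Summit.QuantumFields.BalabanUV.T4Continuum.BlockPairingGeometry (tau)
open Summit.QuantumFields.BalabanUV.T4Continuum.AbelianCovariantLaplacian (tauInv tauInv_tau tau_tauInv)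
open Summit.QuantumFields.BalabanUV.T4Continuum.RegularBackgroundTower (connTower dconnTower connTower_eq)
open Summit.QuantumFields.BalabanUV.T4Continuum.SubstrateBackgroundTransporters (unitMod siteIdx siteIdx_shift towerOf towerOf_of_lt norm_lev)
open Summit.QuantumFields.BalabanUV.T4Continuum.SubstrateAvgTowerStructure (avgTower axialTower)
open Summit.QuantumFields.BalabanUV.T4Continuum.SubstrateAvgTowerFactorisation (towerOf_chart' fin_eq_clause)

/-! ## §1 The second-difference identity for `dconnTower` (pure algebra, any tower) -/

section Algebra

variable {d : ℕ} {o : Type*} [DecidableEq o] {L : ℕ} {M : Fin d → ℕ}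

/-- [folklore] unit translations commute. -/
theorem fineTau_comm (Nf : Fin d → ℕ) (μ ν : Fin d) (i : Tor Nf × Fin d) : tau Nf μ (tau Nf ν i) = tau Nf ν (tau Nf μ i) :=
  Prod.ext (add_right_comm _ _ _) rfl

/-- [folklore] **THE SECOND-DIFFERENCE IDENTITY**: at an index written `i = τ_μ i₀`, the forward `ν`-difference of the lattice-derivative tower
`D_μw_μ = lev • (w_μ − w_μ∘τ_μ⁻¹)`, `w_μ = lev • (R_μ − 1)`, is `lev • lev •` the mixed second difference of the transporters:
`D_μw_μ(τ_ν i) − D_μw_μ(i) = lev • (lev • (R_μ(τ_ν τ_μ i₀) − R_μ(τ_μ i₀) − R_μ(τ_ν i₀) + R_μ(i₀)))`. -/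
theorem dconnTower_tau_sub (R : (k : ℕ) → Fin d → (idx L M k → Matrix o o ℂ)) (k : ℕ) (μ ν : Fin d) (i₀ : idx L M k) :
    dconnTower L M R k μ (tau (fine (lev L k) M) ν (tau (fine (lev L k) M) μ i₀)) - dconnTower L M R k μ (tau (fine (lev L k) M) μ i₀)
      = ((lev L k : ℕ) : ℂ) • (((lev L k : ℕ) : ℂ) •
          (R k μ (tau (fine (lev L k) M) ν (tau (fine (lev L k) M) μ i₀)) - R k μ (tau (fine (lev L k) M) μ i₀)
            - R k μ (tau (fine (lev L k) M) ν i₀) + R k μ i₀)) := by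
  have e1 : tauInv (fine (lev L k) M) μ (tau (fine (lev L k) M) ν (tau (fine (lev L k) M) μ i₀)) = tau (fine (lev L k) M) ν i₀ := by
    rw [fineTau_comm, tauInv_tau]
  have e2 : tauInv (fine (lev L k) M) μ (tau (fine (lev L k) M) μ i₀) = i₀ := tauInv_tau _ _ _
  simp only [dconnTower, e1, e2, connTower_eq, smul_sub, smul_add, smul_smul]
  abel

end Algebra

/-! ## §2 The finest second-order window letter and its discharge of `hlipD` at the levels `k ≥ K` -/

section Finest

variable (P : Params) {G : Type*} [GaugeGroup G] {o : Type*} [Fintype o] [DecidableEq o] (ι : G →* Matrix o o ℂ) (ℰ : LoopAverage G)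

/-- (`Δ_ν Δ_ρ (ι V)(x, μ) = ι V(x+e_ν+e_ρ, μ) − ι V(x+e_ν, μ) − ι V(x+e_ρ, μ) + ι V(x, μ)`.)  HYPOTHESIS SHAPE **`SecondOrderWindow`** — THE FINEST (3.36)-SHAPE SECOND-ORDER WINDOW LETTER `β''` (R60 (2); memo (W2); the third letter of the
(α′, β′, β″)-window of record): `L^K · ‖ι V((x + e_ν) + e_ρ, μ) − ι V(x + e_ν, μ) − ι V(x + e_ρ, μ) + ι V(x, μ)‖ ≤ β''∕(L^K)²` at every finest site, component and pair of
directions (incl. `ν = ρ`).  A hypothesis on data; nothing is asserted about Bałaban's minimisers. [folklore] -/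
def SecondOrderWindow (V : GaugeField P 0 G) (β'' : ℝ) : Prop :=
  ∀ (x : Site P 0) (μ ν ρ : Fin P.d),
    (P.L : ℝ) ^ P.K * ‖ι (V ⟨(x.shift ν).shift ρ, μ⟩) - ι (V ⟨x.shift ν, μ⟩) - ι (V ⟨x.shift ρ, μ⟩) + ι (V ⟨x, μ⟩)‖ ≤ β'' / ((P.L : ℝ) ^ P.K) ^ 2

variable {P}

/-- [folklore] scalar step: `c·N ≤ β∕c²` ⟹ `c·(c·N) ≤ β∕c` for `c > 0`. -/
theorem mul_mul_le_div_of_mul_le_div_sq {c N β : ℝ} (hc : 0 < c) (h : c * N ≤ β / c ^ 2) : c * (c * N) ≤ β / c := by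
  rw [le_div_iff₀ (pow_pos hc 2)] at h
  rw [le_div_iff₀ hc]
  calc c * (c * N) * c = c * N * c ^ 2 := by ring
    _ ≤ β := h

/-- [folklore] **FINEST SECOND-ORDER CLAUSE** (the companion of PART 3's `fin_size_clause` ∕ `fin_lip_clause`, in the same `lev •` currency; JUNCTION J-σ =
the input letter of the NE5 owner's abstract second-order induction g39-d `B13ReadingsAvgTowerSecond` at the finest level): the window letter β″ gives
`‖ℓ•(ℓ•(S_μ(τ_ρ τ_ν i₀) − S_μ(τ_ν i₀) − S_μ(τ_ρ i₀) + S_μ(i₀)))‖ ≤ β''∕ℓ` (= `ℓ²·‖Δ_ν Δ_ρ S_μ (i₀)‖`, any component `μ` and pair `ν, ρ`), `ℓ = lev L k`,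
for `S := towerOf P ι (axialTower V)` at every `k ≥ K`
(`k = K`: the chart dictionary `siteIdx_shift` ∕ `towerOf_chart'`; `k > K`: `S = 1`).  Equivalently `‖Δ²S‖ ≤ β''∕ℓ³` (one `norm_smul`). -/
theorem fin_second_clause (V : GaugeField P 0 G) {β'' : ℝ} (hβ0 : 0 ≤ β'') (hwin : SecondOrderWindow P ι V β'')
    {k : ℕ} (hk : P.K ≤ k) (μ ν ρ : Fin P.d) (i₀ : idx P.L (unitMod P) k) :
    ‖((lev P.L k : ℕ) : ℂ) • (((lev P.L k : ℕ) : ℂ) •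
        (towerOf P ι (axialTower V) k μ (tau (fine (lev P.L k) (unitMod P)) ρ (tau (fine (lev P.L k) (unitMod P)) ν i₀))
          - towerOf P ι (axialTower V) k μ (tau (fine (lev P.L k) (unitMod P)) ν i₀)
          - towerOf P ι (axialTower V) k μ (tau (fine (lev P.L k) (unitMod P)) ρ i₀)
          + towerOf P ι (axialTower V) k μ i₀))‖ ≤ β'' / (lev P.L k : ℕ) := by
  rcases hk.eq_or_lt with h | h
  · subst h
    obtain ⟨y, μ'⟩ := i₀
    obtain ⟨z, rfl⟩ := (siteIdx P (j := 0) (k := P.K) (by omega)).surjective y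
    have htau : ∀ (w : Site P 0) (ρ : Fin P.d), tau (fine (lev P.L P.K) (unitMod P)) ρ (siteIdx P (j := 0) (k := P.K) (by omega) w, μ')
        = (siteIdx P (j := 0) (k := P.K) (by omega) (w.shift ρ), μ') := fun w ρ => by
      rw [siteIdx_shift]; rfl
    simp only [htau]
    rw [towerOf_chart' ι _ (by omega), towerOf_chart' ι _ (by omega), towerOf_chart' ι _ (by omega), towerOf_chart' ι _ (by omega),
      norm_smul, norm_smul, norm_lev, cast_lev']
    have hc : (0 : ℝ) < (P.L : ℝ) ^ P.K := by have := P.L_pos; positivity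
    exact mul_mul_le_div_of_mul_le_div_sq hc (hwin z μ ν ρ)
  · rw [towerOf_of_lt ι _ h]
    simp only [sub_self, zero_sub, neg_add_cancel, smul_zero, norm_zero]
    positivity

/-- [folklore] scalar step: `c·X ≤ β∕c` ⟹ `X ≤ β∕c²` for `c > 0`. -/
theorem le_div_sq_of_mul_le_div {c X β : ℝ} (hc : 0 < c) (h : c * X ≤ β / c) : X ≤ β / c ^ 2 := by
  rw [le_div_iff₀ hc] at h
  rw [le_div_iff₀ (pow_pos hc 2)]
  calc X * c ^ 2 = c * X * c := by ring
    _ ≤ β := h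

/-- [folklore] … the same clause in the SINGLE-`ℓ` currency of `RegularTransporters`-style letters (`‖ℓ•Δ²S‖ ≤ β''∕ℓ²`; the shape of NE5 leaf-08 g19's σ-L2 letter `h2`
in `B13AvgCorrPlaquetteSecond`, up to the order of the two translations ∕ middle terms — one `fineTau_comm`). -/
theorem fin_second_clause_sq (V : GaugeField P 0 G) {β'' : ℝ} (hβ0 : 0 ≤ β'') (hwin : SecondOrderWindow P ι V β'')
    {k : ℕ} (hk : P.K ≤ k) (μ ν ρ : Fin P.d) (i₀ : idx P.L (unitMod P) k) :
    ‖((lev P.L k : ℕ) : ℂ) •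
        (towerOf P ι (axialTower V) k μ (tau (fine (lev P.L k) (unitMod P)) ρ (tau (fine (lev P.L k) (unitMod P)) ν i₀))
          - towerOf P ι (axialTower V) k μ (tau (fine (lev P.L k) (unitMod P)) ν i₀)
          - towerOf P ι (axialTower V) k μ (tau (fine (lev P.L k) (unitMod P)) ρ i₀)
          + towerOf P ι (axialTower V) k μ i₀)‖ ≤ β'' / ((lev P.L k : ℕ) : ℝ) ^ 2 := by
  have h := fin_second_clause ι V hβ0 hwin hk μ ν ρ i₀
  rw [norm_smul, norm_lev, cast_lev'] at h
  rw [cast_lev']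
  have hc : (0 : ℝ) < (P.L : ℝ) ^ k := by have := P.L_pos; positivity
  exact le_div_sq_of_mul_le_div hc h

/-- [folklore] **(ℓ2) `hlipD` AT THE LEVELS `k ≥ K` FROM THE FINEST SECOND-ORDER LETTER** (`βD := β''`): for `R := towerOf P ι (avgTower ℰ V)` (= the axial tower
there, PART 3 `fin_eq_clause`), `‖D_μw_μ(τ_ν i) − D_μw_μ(i)‖ ≤ β''∕lev L k` at every `k ≥ K` — §1 `dconnTower_tau_sub` at `i = τ_μ i₀`, then `fin_second_clause`. -/
theorem hlipD_finest_of_secondOrderWindow (V : GaugeField P 0 G) {β'' : ℝ} (hβ0 : 0 ≤ β'') (hwin : SecondOrderWindow P ι V β'')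
    {k : ℕ} (hk : P.K ≤ k) (μ ν : Fin P.d) (i : idx P.L (unitMod P) k) :
    ‖dconnTower P.L (unitMod P) (towerOf P ι (avgTower ℰ V)) k μ (tau (fine (lev P.L k) (unitMod P)) ν i)
        - dconnTower P.L (unitMod P) (towerOf P ι (avgTower ℰ V)) k μ i‖ ≤ β'' / (lev P.L k : ℕ) := by
  obtain ⟨i₀, rfl⟩ : ∃ i₀, i = tau (fine (lev P.L k) (unitMod P)) μ i₀ := ⟨tauInv _ μ i, (tau_tauInv _ _ _).symm⟩
  rw [dconnTower_tau_sub, fin_eq_clause ι ℰ V hk]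
  exact fin_second_clause ι V hβ0 hwin hk μ μ ν i₀

end Finest

/-! ## §3 Assembly of W-25b §2's all-levels binder `hlipD` -/

section Assembly

variable (P : Params) {G : Type*} [GaugeGroup G] {o : Type*} [Fintype o] [DecidableEq o] (ι : G →* Matrix o o ℂ) (ℰ : LoopAverage G)

/-- [folklore] **W-25b §2's `hlipD` = (levels `k ≥ K`: §2, from β″) + (levels `k < K`: the binder `hbelow` = β″'s PROPAGATION through the averaging tower,
DISPLAYED PER LEVEL, not claimed — abstract half g39-d, instance σ-L1∕σ-L2∕σ-END, Q52)**: the all-levels second-order Lipschitz binder of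
`hloc_avgTower_on_levelWindow` with `βD := β''`. -/
theorem hlipD_of_secondOrderWindow (V : GaugeField P 0 G) {β'' : ℝ} (hβ0 : 0 ≤ β'') (hwin : SecondOrderWindow P ι V β'')
    (hbelow : ∀ k < P.K, ∀ μ ν (i : idx P.L (unitMod P) k),
      ‖dconnTower P.L (unitMod P) (towerOf P ι (avgTower ℰ V)) k μ (tau (fine (lev P.L k) (unitMod P)) ν i)
        - dconnTower P.L (unitMod P) (towerOf P ι (avgTower ℰ V)) k μ i‖ ≤ β'' / (lev P.L k : ℕ)) :
    ∀ k μ ν (i : idx P.L (unitMod P) k),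
      ‖dconnTower P.L (unitMod P) (towerOf P ι (avgTower ℰ V)) k μ (tau (fine (lev P.L k) (unitMod P)) ν i)
        - dconnTower P.L (unitMod P) (towerOf P ι (avgTower ℰ V)) k μ i‖ ≤ β'' / (lev P.L k : ℕ) := by
  intro k μ ν i
  rcases lt_or_ge k P.K with hk | hk
  · exact hbelow k hk μ ν i
  · exact hlipD_finest_of_secondOrderWindow ι ℰ V hβ0 hwin hk μ ν i

/-- [folklore] … in the `∀ b ∈ dom` binder shape of `hloc_avgTower_on_levelWindow_dom`. -/
theorem hlipD_of_secondOrderWindow_dom {BgD : Type*} {dom : Set BgD} (fld : BgD → GaugeField P 0 G) {β'' : ℝ} (hβ0 : 0 ≤ β'')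
    (hwin : ∀ b ∈ dom, SecondOrderWindow P ι (fld b) β'')
    (hbelow : ∀ b ∈ dom, ∀ k < P.K, ∀ μ ν (i : idx P.L (unitMod P) k),
      ‖dconnTower P.L (unitMod P) (towerOf P ι (avgTower ℰ (fld b))) k μ (tau (fine (lev P.L k) (unitMod P)) ν i)
        - dconnTower P.L (unitMod P) (towerOf P ι (avgTower ℰ (fld b))) k μ i‖ ≤ β'' / (lev P.L k : ℕ)) :
    ∀ b ∈ dom, ∀ k μ ν (i : idx P.L (unitMod P) k),
      ‖dconnTower P.L (unitMod P) (towerOf P ι (avgTower ℰ (fld b))) k μ (tau (fine (lev P.L k) (unitMod P)) ν i)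
        - dconnTower P.L (unitMod P) (towerOf P ι (avgTower ℰ (fld b))) k μ i‖ ≤ β'' / (lev P.L k : ℕ) :=
  fun b hb => hlipD_of_secondOrderWindow P ι ℰ (fld b) hβ0 (hwin b hb) (hbelow b hb)

end Assembly

end Summit.QuantumFields.BalabanUV.T4Continuum.SubstrateSecondOrderWindow

end
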